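import Summits.CriticalPhenomena.PercolationContinuityZ3.Theorems.Transplant.FKConnectivityAllQAntipodalMinorDefs
import Summits.CriticalPhenomena.PercolationContinuityZ3.Theorems.Transplant.FKConnectivityAllQAntipodalWeightDefs
import HarnessLib

/-!
# Connectivity correlation inequalities for `φ_{w,q}`, every `q > 0` — file 23c (DEFINITION): the antipodal up-correlation functional
# with a CONTRACTED SET and a GENERAL LEVEL WEIGHT (the object behind "Theorem U holds coefficientwise in `q` AND in the edge odds `z`")

Definitions file (`--supports stmt-CriticalPhenomena-4575`), FK sub-lane `prim-bschramm-fk-2` (gen 21) of the post-continuity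
programme; builds on p205010 (kernel theorem, internal audit signed; external expert review pending).  No named facts, no sorries,
nothing probabilistic.

`…AntipodalMinorDefs.lean` (gen 11) attached to an edge set `E`, a contracted set `C` and terminals `s, t` the functional
`apUpcC q E C s t h = ∑_{γ ⊆ E} q^{k(γ∪C)+k((E\γ)∪C)} (1{s↔t in γ∪C} - 1{s↔t in (E\γ)∪C}) h(γ)` (the coefficient of the monomial
`z^{2·1_C + 1_E}` of the relevant random-cluster covariance polynomial, FK-Q2 §20), and `…AntipodalWeightDefs.lean` (gen 18) replaced,
for `C = ∅`, the geometric level weight `q^ℓ` by an arbitrary sequence `w : ℕ → ℝ`.  This file does both at once: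
* `FK.apUpcCLW w E C s t h = ∑_{γ ⊆ E} w(k(γ∪C)+k((E\γ)∪C)) (1{s↔t in γ∪C} - 1{s↔t in (E\γ)∪C}) h(γ)`;
  `apUpcC q E C = apUpcCLW (q^·) E C` (`FK.apUpcC_eq_apUpcCLW`), `apUpcCLW w E ∅ = apUpcLW w E` (`FK.apUpcCLW_empty_right`).
The sibling `…AntipodalMinorWeightUpc.lean` proves `0 ≤ apUpcCLW w M C s t h` on two-terminal series–parallel networks for every
`w ≥ 0` and every monotone `h` — Theorem U at every cluster level in every cell — and derives the `q`-free (level) form of the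
single-edge antipodal inequality in every cell: the Rayleigh difference of a series–parallel graph, as a polynomial in the edge odds
`z` and the cluster weight `q`, is `(1 − q)` times a polynomial with nonnegative coefficients.
[cite: Grimmett2006, §1.4 eq. (1.20) (p. 15); §3.8 (pp. 61–62)] [cite: Wagner2006, Thm. 5.8(d), §5.3]
-/

noncomputable section

namespace Summit.CriticalPhenomena.PercolationContinuityZ3.Theorems

namespace FK

open Literature.Probability.LatticeModels Literature.Probability.Percolation
open scoped Classical

variable {V : Type*}

/-- **Antipodal up-correlation functional with a contracted set and a general level weight**:
`apUpcCLW w E C s t h = ∑_{γ ⊆ E} w(k(γ∪C)+k((E\γ)∪C)) · (1{s ↔ t in γ∪C} - 1{s ↔ t in (E\γ)∪C}) · h(γ)`; for `w = (q ^ ·)` this is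
`apUpcC q E C s t h`, for `w = 1_{· = ℓ}` the coefficient of `q^ℓ` in `apUpcC · E C s t h`.
[cite: Grimmett2006, §1.4 eq. (1.20) (p. 15); §3.8 (pp. 61–62)] -/
def apUpcCLW (w : ℕ → ℝ) (E C : Finset (Sym2 V)) (s t : V) (h : Finset (Sym2 V) → ℝ) : ℝ :=
  ∑ γ ∈ E.powerset, w (apExpC E C γ) * ((apConn (γ ∪ C) s t - apConn (E \ γ ∪ C) s t) * h γ)

/-- `apUpcC q` is `apUpcCLW` with the geometric weight `n ↦ q^n`. [folklore] -/
theorem apUpcC_eq_apUpcCLW (q : ℝ) (E C : Finset (Sym2 V)) (s t : V) (h : Finset (Sym2 V) → ℝ) :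
    apUpcC q E C s t h = apUpcCLW (fun n => q ^ n) E C s t h := rfl

/-- Without contracted edges the functional is `apUpcLW`. [folklore] -/
theorem apUpcCLW_empty_right (w : ℕ → ℝ) (E : Finset (Sym2 V)) (s t : V) (h : Finset (Sym2 V) → ℝ) :
    apUpcCLW w E ∅ s t h = apUpcLW w E s t h := by
  unfold apUpcCLW apUpcLW apExpC apExp
  simp only [Finset.union_empty]

/-- The functional of the empty free set vanishes. [folklore] -/
theorem apUpcCLW_empty (w : ℕ → ℝ) (C : Finset (Sym2 V)) (s t : V) (h : Finset (Sym2 V) → ℝ) : apUpcCLW w ∅ C s t h = 0 := by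
  unfold apUpcCLW
  rw [Finset.powerset_empty, Finset.sum_singleton, Finset.sdiff_self, sub_self, zero_mul, mul_zero]

end FK

end Summit.CriticalPhenomena.PercolationContinuityZ3.Theorems

end
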